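/-
Copyright: cell `pub-balaban-gaps` (G2), seat ne6 (row NE7b), `prover-pub-balaban-gaps-ne6-g17-0`. Project licence.
-/
import Literature.MathematicalPhysics.QuantumFieldTheory.LatticeGaugePlaquetteLowerBound
import Mathlib.MeasureTheory.Integral.Pi

/-!
# THE TANGENT FLOOR OF THE `SU(N)` ONE-PLAQUETTE MASS, EVERY `N ≥ 2` AND EVERY `β ≥ 0`: `∫ e^{−β·Re tr(1−U)} dHaar_{SU(N)}(U) ≥ e^{−Nβ}` — the mean action
# under Haar is `⟨Re tr(1−U)⟩ = N` (centre twist) and the exponential lies above its tangent at the mean (row NE7b, node U5c; MODEL, [folklore]; census V46)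

Cell `pub-balaban-gaps` (G2 spine census) for the `pub-balaban` T⁴ crux NE7b (`T4WeightBudget.RelWeightBound`; NOT PRINTED, NOT PROVED).  Crux-route work under
`Spine/NE7b/`; imports the TREE's `Literature…LatticeGaugePlaquetteLowerBound` (`PlaquetteLowerBound.integral_reTr_eq_zero`: Haar mean zero of the character of
`SU(N)`, `N ≥ 2`, by the centre twist `tr(ζU) = ζ·tr U`, `ζ ≠ 1`; `TorusAreaLaw.isSpecialUnitaryModel_fundamentalRep`) + Mathlib `Integral.Pi`; no `def`, zero
`sorry`, nothing of Bałaban's asserted.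

THE LOCATED QUESTION.  V39 `CompactFibrePlaquetteMassSUN.exists_le_plaquetteMass` gives `c·β^{−(N²−1)∕2} ≤ Z_N(β)` for `β ≥ 1` with a SOFT `c`; V44's tangent floor
`Z_2(β) ≥ e^{−2β}` used Weyl's density (N = 2 only).  QUESTION (V46): a floor BY VALUE for every `N` and every `β ≥ 0`, without Weyl's formula.  ANSWER ([folklore]):
* §1 **`integral_re_trace_haar_SUN_eq_zero`** (`N ≥ 2`): `∫ Re tr U dHaar_{SU(N)}(U) = 0` (the tree's centre-twist lemma specialised to the defining representation);
  **`integral_re_trace_one_sub_haar_SUN`**: `∫ Re tr(1 − U) dHaar_{SU(N)}(U) = N` — the MEAN one-plaquette action is `N`;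
* §2 **`exp_neg_mul_le_plaquetteMass_SUN`** (`N ≥ 2`, `β ≥ 0`): `e^{−Nβ} ≤ ∫ e^{−β·Re tr(1−U)} dHaar_{SU(N)}(U)` — the tangent line `e^{−βs} ≥ e^{−βN}(1 − β(s − N))`
  integrated (Jensen for the exponential without convexity bookkeeping); `plaquetteMass_SUN_le_one`; and on the product fibre `bonds → SU(N)`
  **`exp_neg_mul_card_le_pi_plaquetteMass_SUN`**: `e^{−Nβ·#bonds} ≤ ∫ Π_b e^{−β·Re tr(1−V_b)} dΠHaar`.

HONEST REMARKS.  (i) MODEL ∕ [folklore]: Haar calculus of ONE `SU(N)` plaquette variable (and the product reference state of the compact-fibre carrier), NOT the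
interacting measure.  (ii) The floor is exponential, not the power law: it is the right shape only at strong∕moderate coupling (for N = 2 it beats V41's Markov floor on
`β < 2.09` and is beaten by V44's `0.1449·β^{−3∕2}` for `β > 3∕4`); the power-law floor for general N stays V39's soft one.  (iii) `N ≥ 2` (for N = 1 the statement is the
trivial `Z = 1`).  (iv) (A3) ∕ (A1c) NOT asserted; NC-NE7b-α UNRULED.  BY-NAME EFFECT ON THE WALL: NONE.  NE7b NOT PRINTED ∕ NOT PROVED; spine PROVED 0∕9; rung (B)+1 on ONE
finite T⁴ — NOT infinite volume, NOT the mass gap, NOT Clay.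
HONEST DEPENDENCY: continuum YM on T⁴ ⇐ BetaPertH ∧ nine spine estimates (0/9 proved); BetaPertH ⇐ (D1) ∧ (D4) ∧ CAP+tail;
G-an2-4 gates asym, D1 and NE2/3/4.  This file changes none of it.
-/

set_option autoImplicit false

noncomputable section

open Real Set MeasureTheory Finset
open Literature.MathematicalPhysics.QuantumLattice (fundamentalRep fundamentalRep_apply)
open Literature.MathematicalPhysics.QuantumFieldTheory (haarProbability abs_re_trace_le_of_mem_unitaryGroup)
open Literature.MathematicalPhysics.QuantumFieldTheory.PlaquetteLowerBound (reTr integral_reTr_eq_zero)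
open Literature.MathematicalPhysics.QuantumFieldTheory.TorusAreaLaw (isSpecialUnitaryModel_fundamentalRep)

namespace Summit.QuantumFields.BalabanUV.T4Continuum.NE7b.CompactFibrePlaquetteMassSUNTangentFloor

variable {N : ℕ}

/-! ### §1 The mean one-plaquette action under Haar -/

/-- **HAAR MEAN ZERO OF THE TRACE ON `SU(N)`, `N ≥ 2`**: `∫ Re tr U dHaar_{SU(N)}(U) = 0` (the tree's centre-twist lemma
`PlaquetteLowerBound.integral_reTr_eq_zero` for the defining representation). [folklore] -/
theorem integral_re_trace_haar_SUN_eq_zero (hN : 2 ≤ N) :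
    ∫ U, (Matrix.trace (U : Matrix (Fin N) (Fin N) ℂ)).re ∂(haarProbability (Matrix.specialUnitaryGroup (Fin N) ℂ)) = 0 := by
  have h := integral_reTr_eq_zero (fundamentalRep (Fin N)) (isSpecialUnitaryModel_fundamentalRep N) hN
  simpa only [reTr, fundamentalRep_apply] using h

/-- `U ↦ Re tr(1 − U)` is continuous on `SU(N)`. -/
theorem continuous_re_trace_one_sub :
    Continuous fun U : Matrix.specialUnitaryGroup (Fin N) ℂ => (Matrix.trace (1 - (U : Matrix (Fin N) (Fin N) ℂ))).re :=
  Complex.continuous_re.comp ((continuous_const.sub continuous_subtype_val).matrix_trace)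

/-- `Re tr(1 − U) = N − Re tr U`. -/
theorem re_trace_one_sub_eq (U : Matrix.specialUnitaryGroup (Fin N) ℂ) :
    (Matrix.trace (1 - (U : Matrix (Fin N) (Fin N) ℂ))).re = N - (Matrix.trace (U : Matrix (Fin N) (Fin N) ℂ)).re := by
  rw [Matrix.trace_sub, Matrix.trace_one, Complex.sub_re, Fintype.card_fin]
  norm_cast

/-- `0 ≤ Re tr(1 − U) ≤ 2N` on `SU(N)` (`|Re tr U| ≤ N` for unitary `U`). [folklore] -/
theorem re_trace_one_sub_mem (U : Matrix.specialUnitaryGroup (Fin N) ℂ) :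
    0 ≤ (Matrix.trace (1 - (U : Matrix (Fin N) (Fin N) ℂ))).re ∧ (Matrix.trace (1 - (U : Matrix (Fin N) (Fin N) ℂ))).re ≤ 2 * (N : ℝ) := by
  have hU : (U : Matrix (Fin N) (Fin N) ℂ) ∈ Matrix.unitaryGroup (Fin N) ℂ := Matrix.specialUnitaryGroup_le_unitaryGroup U.2
  have h := abs_le.1 (abs_re_trace_le_of_mem_unitaryGroup hU)
  rw [re_trace_one_sub_eq]
  constructor <;> linarith [h.1, h.2]

/-- Integrability of `Re tr(1 − U)` against the Haar probability measure (bounded continuous). -/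
theorem integrable_re_trace_one_sub :
    Integrable (fun U : Matrix.specialUnitaryGroup (Fin N) ℂ => (Matrix.trace (1 - (U : Matrix (Fin N) (Fin N) ℂ))).re)
      (haarProbability (Matrix.specialUnitaryGroup (Fin N) ℂ)) :=
  continuous_re_trace_one_sub.integrable_of_hasCompactSupport (HasCompactSupport.of_compactSpace _)

/-- **THE MEAN ONE-PLAQUETTE ACTION IS `N`**: `∫ Re tr(1 − U) dHaar_{SU(N)}(U) = N` for `N ≥ 2`. [folklore] -/
theorem integral_re_trace_one_sub_haar_SUN (hN : 2 ≤ N) :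
    ∫ U, (Matrix.trace (1 - (U : Matrix (Fin N) (Fin N) ℂ))).re ∂(haarProbability (Matrix.specialUnitaryGroup (Fin N) ℂ)) = (N : ℝ) := by
  have hint : Integrable (fun U : Matrix.specialUnitaryGroup (Fin N) ℂ => (Matrix.trace (U : Matrix (Fin N) (Fin N) ℂ)).re)
      (haarProbability (Matrix.specialUnitaryGroup (Fin N) ℂ)) :=
    (Complex.continuous_re.comp (continuous_subtype_val.matrix_trace)).integrable_of_hasCompactSupport (HasCompactSupport.of_compactSpace _)
  have hc : Integrable (fun _ : Matrix.specialUnitaryGroup (Fin N) ℂ => (N : ℝ)) (haarProbability (Matrix.specialUnitaryGroup (Fin N) ℂ)) := integrable_const _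
  simp_rw [re_trace_one_sub_eq]
  rw [integral_sub hc hint, integral_const, integral_re_trace_haar_SUN_eq_zero hN, probReal_univ, one_smul, sub_zero]

/-! ### §2 The tangent floor -/

/-- The tangent line of the exponential at the mean: `e^{−βN}·(1 − β(s − N)) ≤ e^{−βs}` for all real `β, s, N`. [folklore] -/
theorem tangent_le_exp_neg_mul (β s Nr : ℝ) : Real.exp (-(β * Nr)) * (1 - β * (s - Nr)) ≤ Real.exp (-(β * s)) := by
  have h := Real.add_one_le_exp (-(β * (s - Nr)))
  have e : Real.exp (-(β * s)) = Real.exp (-(β * Nr)) * Real.exp (-(β * (s - Nr))) := by rw [← Real.exp_add]; congr 1; ring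
  rw [e]
  exact mul_le_mul_of_nonneg_left (by linarith) (Real.exp_pos _).le

/-- **THE TANGENT FLOOR, EVERY `N ≥ 2`, EVERY `β`**: `e^{−Nβ} ≤ ∫ e^{−β·Re tr(1−U)} dHaar_{SU(N)}(U)` — the one-plaquette mass is at least the Boltzmann factor of the
MEAN action `N` (Jensen's inequality for the exponential, proved by integrating the tangent line at the mean; no sign condition on `β` is needed). [folklore] -/
theorem exp_neg_mul_le_plaquetteMass_SUN (hN : 2 ≤ N) (β : ℝ) :
    Real.exp (-(N * β))
      ≤ ∫ U, Real.exp (-(β * (Matrix.trace (1 - (U : Matrix (Fin N) (Fin N) ℂ))).re)) ∂(haarProbability (Matrix.specialUnitaryGroup (Fin N) ℂ)) := by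
  set μ := haarProbability (Matrix.specialUnitaryGroup (Fin N) ℂ) with hμ
  have hs := integrable_re_trace_one_sub (N := N)
  have hexp : Integrable (fun U : Matrix.specialUnitaryGroup (Fin N) ℂ => Real.exp (-(β * (Matrix.trace (1 - (U : Matrix (Fin N) (Fin N) ℂ))).re))) μ :=
    (Real.continuous_exp.comp ((continuous_re_trace_one_sub.const_mul β).neg)).integrable_of_hasCompactSupport (HasCompactSupport.of_compactSpace _)
  have hc1 : Integrable (fun _ : Matrix.specialUnitaryGroup (Fin N) ℂ => (1 : ℝ)) μ := integrable_const _
  have hcN : Integrable (fun _ : Matrix.specialUnitaryGroup (Fin N) ℂ => (N : ℝ)) μ := integrable_const _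
  have hd : Integrable (fun U : Matrix.specialUnitaryGroup (Fin N) ℂ => (Matrix.trace (1 - (U : Matrix (Fin N) (Fin N) ℂ))).re - (N : ℝ)) μ := hs.sub hcN
  have hβd : Integrable (fun U : Matrix.specialUnitaryGroup (Fin N) ℂ => β * ((Matrix.trace (1 - (U : Matrix (Fin N) (Fin N) ℂ))).re - (N : ℝ))) μ := hd.const_mul β
  have hlin : Integrable (fun U : Matrix.specialUnitaryGroup (Fin N) ℂ => 1 - β * ((Matrix.trace (1 - (U : Matrix (Fin N) (Fin N) ℂ))).re - (N : ℝ))) μ := hc1.sub hβd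
  have htan : Integrable (fun U : Matrix.specialUnitaryGroup (Fin N) ℂ =>
      Real.exp (-(β * N)) * (1 - β * ((Matrix.trace (1 - (U : Matrix (Fin N) (Fin N) ℂ))).re - N))) μ := hlin.const_mul _
  have hmono := integral_mono htan hexp fun U => tangent_le_exp_neg_mul β _ (N : ℝ)
  have hval : ∫ U, Real.exp (-(β * N)) * (1 - β * ((Matrix.trace (1 - (U : Matrix (Fin N) (Fin N) ℂ))).re - N)) ∂μ = Real.exp (-(β * N)) := by
    have h1 : ∫ U, (Matrix.trace (1 - (U : Matrix (Fin N) (Fin N) ℂ))).re - (N : ℝ) ∂μ = 0 := by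
      rw [integral_sub hs hcN, integral_re_trace_one_sub_haar_SUN hN, integral_const, probReal_univ, one_smul, sub_self]
    have h2 : ∫ U, (1 - β * ((Matrix.trace (1 - (U : Matrix (Fin N) (Fin N) ℂ))).re - (N : ℝ))) ∂μ = 1 := by
      rw [integral_sub hc1 hβd, integral_const_mul, h1, integral_const, probReal_univ]; simp
    rw [integral_const_mul, h2, mul_one]
  rw [hval] at hmono
  rwa [mul_comm (N : ℝ) β]

/-- The one-plaquette mass is at most `1` for `β ≥ 0` (`Re tr(1 − U) ≥ 0`). [folklore] -/
theorem plaquetteMass_SUN_le_one {β : ℝ} (hβ : 0 ≤ β) :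
    ∫ U, Real.exp (-(β * (Matrix.trace (1 - (U : Matrix (Fin N) (Fin N) ℂ))).re)) ∂(haarProbability (Matrix.specialUnitaryGroup (Fin N) ℂ)) ≤ 1 := by
  have h := integral_mono_of_nonneg (μ := haarProbability (Matrix.specialUnitaryGroup (Fin N) ℂ))
    (f := fun U : Matrix.specialUnitaryGroup (Fin N) ℂ => Real.exp (-(β * (Matrix.trace (1 - (U : Matrix (Fin N) (Fin N) ℂ))).re)))
    (g := fun _ => (1 : ℝ)) (ae_of_all _ fun U => (Real.exp_pos _).le) (integrable_const _)
    (ae_of_all _ fun U => by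
      rw [Real.exp_le_one_iff]
      nlinarith [(re_trace_one_sub_mem U).1])
  simpa [integral_const, probReal_univ] using h

/-- **THE TANGENT FLOOR ON THE PRODUCT FIBRE**: on `bonds → SU(N)` with product Haar, `e^{−Nβ·#bonds} ≤ ∫ Π_b e^{−β·Re tr(1−V_b)} dΠHaar` for `N ≥ 2` and every `β`
(the reference state of the compact-fibre carrier; product of the one-plaquette floors). [folklore] -/
theorem exp_neg_mul_card_le_pi_plaquetteMass_SUN {B : Type*} [Fintype B] (hN : 2 ≤ N) (β : ℝ) :
    Real.exp (-(N * β * Fintype.card B))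
      ≤ ∫ V, ∏ b, Real.exp (-(β * (Matrix.trace (1 - ((V b : Matrix.specialUnitaryGroup (Fin N) ℂ) : Matrix (Fin N) (Fin N) ℂ))).re))
          ∂(Measure.pi fun _ : B => haarProbability (Matrix.specialUnitaryGroup (Fin N) ℂ)) := by
  set g : Matrix.specialUnitaryGroup (Fin N) ℂ → ℝ := fun U => Real.exp (-(β * (Matrix.trace (1 - (U : Matrix (Fin N) (Fin N) ℂ))).re)) with hg
  have hprod : ∫ V, ∏ b, Real.exp (-(β * (Matrix.trace (1 - ((V b : Matrix.specialUnitaryGroup (Fin N) ℂ) : Matrix (Fin N) (Fin N) ℂ))).re))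
      ∂(Measure.pi fun _ : B => haarProbability (Matrix.specialUnitaryGroup (Fin N) ℂ))
      = (∫ U, g U ∂(haarProbability (Matrix.specialUnitaryGroup (Fin N) ℂ))) ^ Fintype.card B := integral_fintype_prod_eq_pow g
  rw [hprod]
  have h1 : Real.exp (-(N * β)) ≤ ∫ U, g U ∂(haarProbability (Matrix.specialUnitaryGroup (Fin N) ℂ)) := exp_neg_mul_le_plaquetteMass_SUN hN β
  calc Real.exp (-(N * β * Fintype.card B)) = Real.exp (-(N * β)) ^ Fintype.card B := by
        rw [← Real.exp_nat_mul]; congr 1; ring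
    _ ≤ (∫ U, g U ∂(haarProbability (Matrix.specialUnitaryGroup (Fin N) ℂ))) ^ Fintype.card B :=
        pow_le_pow_left₀ (Real.exp_pos _).le h1 _

end Summit.QuantumFields.BalabanUV.T4Continuum.NE7b.CompactFibrePlaquetteMassSUNTangentFloor

end
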